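import Literature.NumberTheory.Transcendental.KZDominatedFamily
import Literature.NumberTheory.Transcendental.KZLogCalculusProofs

/-!
# Route ValuedFieldSpecialisation — crux `ParametricLifting` (stmt-KontsevichZagierPeriods-3498):
the Frullani calibration, stub `frullani_dominated_R` (the truncated family is dominated)

In the Frullani sector of the regularised lifting mechanism (lead c6) the truncated family is
`R₁ = ({0 < s, 2s < 1, s ≤ t ≤ 1}, g t)` with `g t = 1/((1+t)(1+2t))`, parameter `s = z 0`, fibre
variable `t = z 1` (a `KZlog.band` over the base `G = {0 < y 0, 2 y 0 < 1}`). As `s → 0⁺` its slices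
`{s ≤ t ≤ 1}` increase to `(0,1]` and the integrand does not depend on `s`, so `R₁` is dominated
(`KZ.IsDominatedFamily R₁ r r`, envelope `ε = 1`) by its own special fibre
`r = ((0,1], 1/((1+t)(1+2t)))`, which we CONSTRUCT here (bounded continuous integrand on a subset
of the compact segment `[0,1]`, KZ's rational shape `1 / ((1 + X₀)(1 + 2X₀))`).

Sources: M. Kontsevich, D. Zagier, *Periods* (2001), §1.2; Lebesgue's dominated convergence
(the three clauses of `KZ.IsDominatedFamily`). No new definitions.
-/

noncomputable section

namespace Summit.KontsevichZagierPeriods.ValuedFieldSpecialisation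

open MeasureTheory Set Filter
open scoped Topology
open Literature.NumberTheory.Transcendental Literature.NumberTheory.Transcendental.KZ
open Literature.ModelTheory.ExponentialFields (IsSemialgebraic isSemialgebraic_setOf_eval_pos
  isSemialgebraic_setOf_eval_lt isSemialgebraic_setOf_eval_le)

/-- **The special fibre `r = ((0,1], 1/((1+t)(1+2t)))` of the truncated Frullani family**: an
integral representation in dimension `1` with domain `(0,1]`, integrand
`((1 + x 0) * (1 + 2 * x 0))⁻¹` (continuous on the compact segment `[0,1] ⊇ (0,1]`, hence
integrable) and KZ's rational shape `1 / ((1 + X₀) * (1 + 2 X₀))`.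
[Kontsevich–Zagier 2001, §1.1] [folklore] -/
theorem frullani_exists_specialRep_R :
    ∃ r : KZ.IntegralRep 1, r.domain = {x | 0 < x 0 ∧ x 0 ≤ 1} ∧
      (r.integrand = fun x => ((1 + x 0) * (1 + 2 * x 0))⁻¹) ∧ r.IsRational := by
  -- the domain `(0,1]`
  have hσ : IsSemialgebraic ℚ {x : Fin 1 → ℝ | 0 < x 0 ∧ x 0 ≤ 1} := by
    have h1 : IsSemialgebraic ℚ {x : Fin 1 → ℝ | 0 < x 0} := by
      simpa using isSemialgebraic_setOf_eval_pos (k := ℚ) (R := ℝ) (MvPolynomial.X (0 : Fin 1))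
    have h2 : IsSemialgebraic ℚ {x : Fin 1 → ℝ | x 0 ≤ 1} := by
      simpa using isSemialgebraic_setOf_eval_le (k := ℚ) (R := ℝ) (MvPolynomial.X (0 : Fin 1)) 1
    rw [setOf_and]
    exact h1.inter h2
  -- the denominator does not vanish on the closed segment `[0,1]`
  have hne : ∀ x ∈ {x : Fin 1 → ℝ | 0 ≤ x 0 ∧ x 0 ≤ 1}, ((1 + x 0) * (1 + 2 * x 0) : ℝ) ≠ 0 := by
    intro x hx
    have hx0 : 0 ≤ x 0 := hx.1
    positivity
  have hq : ∀ x ∈ {x : Fin 1 → ℝ | 0 < x 0 ∧ x 0 ≤ 1}, MvPolynomial.aeval x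
      ((1 + MvPolynomial.X (0 : Fin 1)) * (1 + 2 * MvPolynomial.X 0) : MvPolynomial (Fin 1) ℚ) ≠ 0 := by
    intro x hx
    simpa using hne x ⟨hx.1.le, hx.2⟩
  have hsa : IsSemialgebraicFunOn ℚ {x : Fin 1 → ℝ | 0 < x 0 ∧ x 0 ≤ 1}
      (fun x : Fin 1 → ℝ => ((1 + x 0) * (1 + 2 * x 0))⁻¹) :=
    (isSemialgebraicFunOn_aeval_div_aeval hσ 1 ((1 + MvPolynomial.X 0) * (1 + 2 * MvPolynomial.X 0))
      hq).congr fun x _ => by simp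
  -- integrability: continuous on the compact segment `[0,1]`, then restrict to `(0,1]`
  have hK : IsCompact {x : Fin 1 → ℝ | 0 ≤ x 0 ∧ x 0 ≤ 1} := by
    have : {x : Fin 1 → ℝ | 0 ≤ x 0 ∧ x 0 ≤ 1} = Icc (fun _ => (0 : ℝ)) (fun _ => 1) := by
      ext x
      simp only [mem_setOf_eq, mem_Icc, Pi.le_def, Fin.forall_fin_one]
    rw [this]
    exact isCompact_Icc
  have hint : IntegrableOn (fun x : Fin 1 → ℝ => ((1 + x 0) * (1 + 2 * x 0))⁻¹)
      {x : Fin 1 → ℝ | 0 < x 0 ∧ x 0 ≤ 1} :=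
    (ContinuousOn.integrableOn_compact hK (ContinuousOn.inv₀ (by fun_prop) hne)).mono_set
      fun x hx => ⟨hx.1.le, hx.2⟩
  refine ⟨⟨{x | 0 < x 0 ∧ x 0 ≤ 1}, fun x => ((1 + x 0) * (1 + 2 * x 0))⁻¹, hσ, hsa, hint⟩, rfl, rfl,
    1, (1 + MvPolynomial.X 0) * (1 + 2 * MvPolynomial.X 0), hq, fun x _ => ?_⟩
  simp

/-- Slices of the band `{0 < s, 2s < 1, s ≤ t ≤ 1}`: the point `(s, x)` lies in it iff
`0 < s`, `2 s < 1` and `s ≤ x 0 ≤ 1`. [folklore] -/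
theorem frullani_vecCons_mem_band_R (s : ℝ) (x : Fin 1 → ℝ) :
    Matrix.vecCons s x ∈ KZlog.band {y : Fin 1 → ℝ | 0 < y 0 ∧ 2 * y 0 < 1} (fun y => y 0)
      (fun _ => 1) ↔ (0 < s ∧ 2 * s < 1) ∧ s ≤ x 0 ∧ x 0 ≤ 1 := by
  simp [KZlog.mem_band, Fin.init]

/-- **Stub F₁ (the truncated family is dominated by its special fibre `r`).** For the truncated
Frullani family `R₁ = ({0 < s, 2s < 1, s ≤ t ≤ 1}, 1/((1+t)(1+2t)))` there is the special fibre
`r = ((0,1], 1/((1+t)(1+2t)))`, of KZ's rational shape, with `KZ.IsDominatedFamily R₁ r r`: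
(1) for `z` in the band the fibre point `t = z 1 ∈ (0,1]` and `|g t| ≤ g t` (`g > 0`); (2) for
every `x`, eventually as `s → 0⁺`, `(s, x) ∈ R₁.domain ↔ x ∈ (0,1]`; (3) the integrand does not
depend on `s`. [folklore] -/
theorem frullani_dominated_R :
    ∀ (R₁ : KZ.IntegralRep (1 + 1)), R₁.domain = KZlog.band {y : Fin 1 → ℝ | 0 < y 0 ∧ 2 * y 0 < 1} (fun y => y 0) (fun _ => 1) → (R₁.integrand = fun z => ((1 + z 1) * (1 + 2 * z 1))⁻¹) → ∃ r : KZ.IntegralRep 1, r.domain = {x | 0 < x 0 ∧ x 0 ≤ 1} ∧ (r.integrand = fun x => ((1 + x 0) * (1 + 2 * x 0))⁻¹) ∧ r.IsRational ∧ KZ.IsDominatedFamily R₁ r r := by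
  intro R₁ hR₁d hR₁i
  obtain ⟨r, hrd, hri, hrat⟩ := frullani_exists_specialRep_R
  refine ⟨r, hrd, hri, hrat, ⟨1, one_pos, fun z hz _ _ => ?_⟩, ?_, ?_⟩
  · -- clause (1): the envelope is `r` itself
    rw [hR₁d, KZlog.mem_band] at hz
    obtain ⟨hz0, hz01, hz1⟩ := hz
    have hz0' : 0 < z 0 := by simpa [Fin.init] using hz0.1
    have ht0 : 0 < z 1 := hz0'.trans_le (by simpa [Fin.init] using hz01)
    have ht1 : z 1 ≤ 1 := by simpa using hz1
    have hpos : 0 < ((1 + z 1) * (1 + 2 * z 1))⁻¹ := by positivity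
    refine ⟨?_, ?_⟩
    · rw [hrd]
      exact ⟨by simpa using ht0, by simpa using ht1⟩
    · rw [hR₁i, hri]
      simp only [Fin.succ_zero_eq_one]
      exact (abs_of_pos hpos).le
  · -- clause (2): the slices `{s ≤ t ≤ 1}` increase to `(0,1]`
    refine ae_of_all _ fun x => ?_
    rw [hrd]
    by_cases hx : 0 < x 0
    · filter_upwards [Ioo_mem_nhdsGT (lt_min hx (by norm_num : (0 : ℝ) < 1 / 2))] with s hs
      rw [hR₁d, frullani_vecCons_mem_band_R]
      have hs0 : 0 < s := hs.1
      have hs1 : s < x 0 := hs.2.trans_le (min_le_left _ _)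
      have hs2 : s < 1 / 2 := hs.2.trans_le (min_le_right _ _)
      constructor
      · rintro ⟨-, -, h⟩
        exact ⟨hx, h⟩
      · rintro ⟨-, h⟩
        exact ⟨⟨hs0, by linarith⟩, hs1.le, h⟩
    · filter_upwards [self_mem_nhdsWithin] with s hs
      rw [hR₁d, frullani_vecCons_mem_band_R]
      have hs0 : 0 < s := hs
      constructor
      · rintro ⟨-, h, -⟩
        exact absurd (hs0.trans_le h) hx
      · rintro ⟨h, -⟩
        exact absurd h hx
  · -- clause (3): the integrand does not depend on the parameter
    refine ae_of_all _ fun x _ => ?_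
    rw [hR₁i, hri]
    simp only [Matrix.cons_val_one]
    exact tendsto_const_nhds

end Summit.KontsevichZagierPeriods.ValuedFieldSpecialisation
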